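import Mathlib
import Summits.Ventures.Crystal3D.Theorems.StickyWulffConstantTextureLiminfTentClassify
import Summits.Ventures.Crystal3D.Theorems.StickyWulffConstantTextureLiminfTentComplexDefs
import HarnessLib

/-!
# The tent certificate for fcc grains — the complex carries the tent (eng g8)

Route `StickyWulffConstant` (`Summits/Ventures/Crystal3D`, cell `crystal3d-full`), support toward the crux
`TextureLiminf` (stmt-Ventures-19483), FREE half (tent certificate, TexShadow v6.1).
* `mem_cellOf_floor` — a point off all planes of the arrangement lies in the open chamber of its floor
  label; `exists_near_off_planes` — such points are dense (move along `(1,2,4)`, countably many bad steps);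
* `exists_pos_term_of_tent_pos` — where the tent is positive some hat is positive;
  `anchor_mem_idx_of_hatL_pos` / `eq_corner_of_hatH_pos` — a hat positive somewhere on a closed chamber
  has its centre at a VERTEX of that chamber (an affine function with vanishing vertex values vanishes),
  so the chamber is anchored at `idx X`;
* `mem_closure_cells_of_tent_pos` — **`{f_X > 0} ⊆ ⋃_{ℓ ∈ labelsOf X} closure (cellOf ℓ)`** (the
  hypothesis `hcov` of the level-set toolkit), and `mem_balls_of_tent_pos` —
  `{f_X > 0} ⊆ ⋃_{a ∈ X} closedBall (site a) √2`.
WHAT THIS IS NOT: the certificate (next file); F-C1 not moved.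
-/

noncomputable section

namespace Summit.Ventures.Crystal3D.TentCertificate

open Finset Summit.Ventures.Crystal3D MeasureTheory
open Literature.Geometry.DiscreteGeometry (intVec intVec_apply)
open scoped RealInnerProductSpace ENNReal

/-! ## Floor labels and density of points off the planes -/

/-- A point off all the planes `y_i ∈ ℤ`, `⟪a_j, y⟫ ∈ 2ℤ` (`y = √2 • x`) lies in the open chamber of its
floor label. -/
theorem mem_cellOf_floor {x : EuclideanSpace ℝ (Fin 3)} (h1 : ∀ i : Fin 3, ∀ n : ℤ, Real.sqrt 2 * x i ≠ n)
    (h2 : ∀ j : Fin 4, ∀ n : ℤ, ⟪intVec (normal4 j), Real.sqrt 2 • x⟫ ≠ 2 * n) :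
    x ∈ cellOf (fun i => ⌊Real.sqrt 2 * x i⌋) (fun j => ⌊⟪intVec (normal4 j), Real.sqrt 2 • x⟫ / 2⌋) := by
  rw [mem_cellOf_iff]
  refine ⟨fun i => ⟨?_, ?_⟩, fun j => ⟨?_, ?_⟩⟩
  · exact lt_of_le_of_ne (Int.floor_le _) (fun h => h1 i _ h.symm)
  · exact Int.lt_floor_add_one _
  · have hle : ((⌊⟪intVec (normal4 j), Real.sqrt 2 • x⟫ / 2⌋ : ℤ) : ℝ) ≤
        ⟪intVec (normal4 j), Real.sqrt 2 • x⟫ / 2 := Int.floor_le _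
    have hne := h2 j ⌊⟪intVec (normal4 j), Real.sqrt 2 • x⟫ / 2⌋
    rcases lt_or_eq_of_le (by linarith : 2 * ((⌊⟪intVec (normal4 j), Real.sqrt 2 • x⟫ / 2⌋ : ℤ) : ℝ) ≤
        ⟪intVec (normal4 j), Real.sqrt 2 • x⟫) with h | h
    · exact h
    · exact absurd h.symm hne
  · have := Int.lt_floor_add_one (⟪intVec (normal4 j), Real.sqrt 2 • x⟫ / 2)
    linarith

/-- **Points off all the planes are dense**: within any distance of any point there is a point none of
whose `D₃` coordinates is an integer and none of whose `(111)` levels is an even integer. -/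
theorem exists_near_off_planes (x : EuclideanSpace ℝ (Fin 3)) {ε : ℝ} (hε : 0 < ε) :
    ∃ z : EuclideanSpace ℝ (Fin 3), dist z x < ε ∧ (∀ i : Fin 3, ∀ n : ℤ, Real.sqrt 2 * z i ≠ n) ∧
      (∀ j : Fin 4, ∀ n : ℤ, ⟪intVec (normal4 j), Real.sqrt 2 • z⟫ ≠ 2 * n) := by
  set w : EuclideanSpace ℝ (Fin 3) := intVec ![1, 2, 4] with hw
  have hwi : ∀ i : Fin 3, (w i : ℝ) ≠ 0 := by intro i; fin_cases i <;> simp [hw, intVec_apply]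
  have hwj : ∀ j : Fin 4, ⟪intVec (normal4 j), w⟫ ≠ 0 := by
    intro j; rw [hw, inner_intVec_intVec]; fin_cases j <;> simp [normal4]
  have hs : (0 : ℝ) < Real.sqrt 2 := by positivity
  -- the countable set of bad steps
  set B : Set ℝ := (⋃ i : Fin 3, ⋃ n : ℤ, {((n : ℝ) - Real.sqrt 2 * x i) / (Real.sqrt 2 * w i)}) ∪
    (⋃ j : Fin 4, ⋃ n : ℤ, {((2 * n : ℝ) - ⟪intVec (normal4 j), Real.sqrt 2 • x⟫) /
      (Real.sqrt 2 * ⟪intVec (normal4 j), w⟫)}) with hB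
  have hBc : B.Countable := by
    refine Set.Countable.union ?_ ?_
    · exact Set.countable_iUnion fun i => Set.countable_iUnion fun n => Set.countable_singleton _
    · exact Set.countable_iUnion fun j => Set.countable_iUnion fun n => Set.countable_singleton _
  -- a good step in `(0, ε / (‖w‖ + 1))`
  have hwpos : 0 < ‖w‖ + 1 := by positivity
  set r : ℝ := ε / (‖w‖ + 1) with hr
  have hrpos : 0 < r := div_pos hε hwpos
  have hex : ∃ δ ∈ Set.Ioo (0 : ℝ) r, δ ∉ B := by
    by_contra hcon
    push Not at hcon
    have hsub : Set.Ioo (0 : ℝ) r ⊆ B := fun δ hδ => hcon δ hδ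
    have h0 : volume (Set.Ioo (0 : ℝ) r) = 0 := measure_mono_null hsub (hBc.measure_zero volume)
    rw [Real.volume_Ioo] at h0
    have : (0 : ENNReal) < ENNReal.ofReal (r - 0) := by rw [ENNReal.ofReal_pos]; linarith
    exact this.ne' h0
  obtain ⟨δ, ⟨hδ0, hδr⟩, hδB⟩ := hex
  refine ⟨x + δ • w, ?_, fun i n hn => hδB ?_, fun j n hn => hδB ?_⟩
  · rw [dist_eq_norm, add_sub_cancel_left, norm_smul, Real.norm_eq_abs, abs_of_pos hδ0]
    calc δ * ‖w‖ ≤ r * ‖w‖ := mul_le_mul_of_nonneg_right hδr.le (norm_nonneg _)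
      _ < ε := by
        rw [hr, div_mul_eq_mul_div, div_lt_iff₀ hwpos]; nlinarith [norm_nonneg w]
  · -- `√2 (x + δ w)_i = n` puts `δ` in `B`
    refine Set.mem_union_left _ (Set.mem_iUnion.2 ⟨i, Set.mem_iUnion.2 ⟨n, ?_⟩⟩)
    simp only [Set.mem_singleton_iff]
    simp only [PiLp.add_apply, PiLp.smul_apply, smul_eq_mul] at hn
    have hne : Real.sqrt 2 * w i ≠ 0 := mul_ne_zero hs.ne' (hwi i)
    rw [eq_div_iff hne]
    linear_combination hn
  · refine Set.mem_union_right _ (Set.mem_iUnion.2 ⟨j, Set.mem_iUnion.2 ⟨n, ?_⟩⟩)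
    simp only [Set.mem_singleton_iff]
    have hn' : ⟪intVec (normal4 j), Real.sqrt 2 • (x + δ • w)⟫ =
        ⟪intVec (normal4 j), Real.sqrt 2 • x⟫ + δ * (Real.sqrt 2 * ⟪intVec (normal4 j), w⟫) := by
      simp only [smul_add, inner_add_right, smul_smul, real_inner_smul_right]; ring
    have hne : Real.sqrt 2 * ⟪intVec (normal4 j), w⟫ ≠ 0 := mul_ne_zero hs.ne' (hwj j)
    rw [eq_div_iff hne]
    linear_combination hn - hn'

/-! ## Where the tent is positive, a hat centred at a vertex of the chamber is positive -/

/-- Some hat is positive where the tent is positive. -/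
theorem exists_pos_term_of_tent_pos {X : Finset Site} {z : EuclideanSpace ℝ (Fin 3)} (h : 0 < tent X z) :
    (∃ w ∈ X, 0 < hatL (Real.sqrt 2 • z - intVec (fccPoint w))) ∨
    (∃ p ∈ idx X, 0 < twoAlpha (patO X p) ∧ 0 < hatH (Real.sqrt 2 • z - intVec (holeZ p))) := by
  by_contra hcon
  push Not at hcon
  obtain ⟨hL, hH⟩ := hcon
  have h1 : ∑ w ∈ X, hatL (Real.sqrt 2 • z - intVec (fccPoint w)) = 0 :=
    Finset.sum_eq_zero fun w hw => le_antisymm (hL w hw) (hatL_nonneg _)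
  have h2 : ∑ p ∈ idx X, ((twoAlpha (patO X p) : ℝ) / 2) * hatH (Real.sqrt 2 • z - intVec (holeZ p)) = 0 := by
    refine Finset.sum_eq_zero fun p hp => ?_
    have ha := twoAlpha_nonneg (patO X p)
    rcases lt_or_eq_of_le ha with ha' | ha'
    · have := hH p hp ha'
      rw [le_antisymm this (hatH_nonneg _), mul_zero]
    · rw [← ha']; simp
  have : tent X z = 0 := by rw [tent, h1, h2, add_zero]
  linarith

/-- `√2 • site q = fccPoint q` and `√2 • centre p = holeZ p` (in `intVec` form). -/
theorem sqrt2_smul_site (q : Site) : Real.sqrt 2 • site q = intVec (fccPoint q) := by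
  rw [site_eq, sqrt2_smul_inv_smul]

/-- `√2 • centre p = holeZ p`. -/
theorem sqrt2_smul_centre (p : Site) : Real.sqrt 2 • centre p = intVec (holeZ p) := by
  rw [centre_eq, sqrt2_smul_inv_smul]

/-- **A lattice hat positive on a closed chamber is centred at a vertex**: hence the chamber's anchor
belongs to `idx X`. -/
theorem anchor_mem_idx_of_hatL_pos {X : Finset Site} {w : Site} (hw : w ∈ X) (p : Site)
    (κ : Bool ⊕ (Fin 3 → Bool)) {z : EuclideanSpace ℝ (Fin 3)}
    (hz : z ∈ closedChamber (labelOf p κ).1 (labelOf p κ).2)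
    (hpos : 0 < hatL (Real.sqrt 2 • z - intVec (fccPoint w))) : p ∈ idx X := by
  obtain ⟨g, b, hgb⟩ := exists_affine_hatL_shift (labelOf p κ).1 (labelOf p κ).2 w
  have hval : ∀ q : Site, hatL (Real.sqrt 2 • site q - intVec (fccPoint w)) = if q = w then 1 else 0 := by
    intro q; rw [sqrt2_smul_site, hatL_intVec_fccPoint_sub]
  rcases κ with b' | s
  · rcases Bool.eq_false_or_eq_true b' with hb | hb
    · -- up-tetrahedron
      have hz' : z ∈ closedChamber (labelUp p).1 (labelUp p).2 := by simpa [labelOf, hb] using hz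
      have hgb' : ∀ x ∈ closedChamber (labelUp p).1 (labelUp p).2,
          hatL (Real.sqrt 2 • x - intVec (fccPoint w)) = ⟪g, x⟫ + b := by simpa [labelOf, hb] using hgb
      by_contra hp
      have hne : ∀ j : Fin 4, p + tetUpV j ≠ w := fun j h => hp (by
        have := mem_idx hw (tetUpV_mem j); rwa [← h, add_sub_cancel_right] at this)
      obtain ⟨t₀, t₁, t₂, -, -, -, -, hcombo⟩ := affine_eq_combo_labelUp p g b hz'
      have hv : ∀ j : Fin 4, ⟪g, site (p + tetUpV j)⟫ + b = 0 := by
        intro j; rw [← hgb' _ (site_tetUpV_mem_closedChamber p j), hval, if_neg (hne j)]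
      rw [← hgb' z hz', hv, hv, hv, hv] at hcombo
      linarith
    · -- down-tetrahedron
      have hz' : z ∈ closedChamber (labelDn p).1 (labelDn p).2 := by simpa [labelOf, hb] using hz
      have hgb' : ∀ x ∈ closedChamber (labelDn p).1 (labelDn p).2,
          hatL (Real.sqrt 2 • x - intVec (fccPoint w)) = ⟪g, x⟫ + b := by simpa [labelOf, hb] using hgb
      by_contra hp
      have hne : ∀ j : Fin 4, p + tetDnV j ≠ w := fun j h => hp (by
        have := mem_idx hw (tetDnV_mem j); rwa [← h, add_sub_cancel_right] at this)
      obtain ⟨t₀, t₁, t₂, -, -, -, -, hcombo⟩ := affine_eq_combo_labelDn p g b hz'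
      have hv : ∀ j : Fin 4, ⟪g, site (p + tetDnV j)⟫ + b = 0 := by
        intro j; rw [← hgb' _ (site_tetDnV_mem_closedChamber p j), hval, if_neg (hne j)]
      rw [← hgb' z hz', hv, hv, hv, hv] at hcombo
      linarith
  · -- corner
    have hz' : z ∈ closedChamber (labelCorner p s).1 (labelCorner p s).2 := by simpa [labelOf] using hz
    have hgb' : ∀ x ∈ closedChamber (labelCorner p s).1 (labelCorner p s).2,
        hatL (Real.sqrt 2 • x - intVec (fccPoint w)) = ⟪g, x⟫ + b := by simpa [labelOf] using hgb
    by_contra hp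
    have hne : ∀ a : Fin 3, p + octV (octIdx a (s a)) ≠ w := fun a h => hp (by
      have := mem_idx hw (octV_mem (octIdx a (s a))); rwa [← h, add_sub_cancel_right] at this)
    obtain ⟨t₀, t₁, t₂, -, -, -, -, hcombo⟩ := affine_eq_combo_labelCorner p s g b hz'
    have hv : ∀ a : Fin 3, ⟪g, site (p + octV (octIdx a (s a)))⟫ + b = 0 := by
      intro a; rw [← hgb' _ (site_octV_mem_closedChamber p s a), hval, if_neg (hne a)]
    have hc : ⟪g, centre p⟫ + b = 0 := by
      rw [← hgb' _ (centre_mem_closedChamber p s), sqrt2_smul_centre, hatL_intVec_holeZ_sub]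
    rw [← hgb' z hz', hc, hv, hv, hv] at hcombo
    linarith

/-- **A hole hat positive on a closed chamber is centred at the apex of that chamber**: the chamber is
the corner of THAT octahedron. -/
theorem eq_corner_of_hatH_pos (p p' : Site) (κ : Bool ⊕ (Fin 3 → Bool)) {z : EuclideanSpace ℝ (Fin 3)}
    (hz : z ∈ closedChamber (labelOf p κ).1 (labelOf p κ).2)
    (hpos : 0 < hatH (Real.sqrt 2 • z - intVec (holeZ p'))) : ∃ s, κ = Sum.inr s ∧ p = p' := by
  obtain ⟨g, b, hgb⟩ := exists_affine_hatH_shift (labelOf p κ).1 (labelOf p κ).2 p'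
  have hval : ∀ q : Site, hatH (Real.sqrt 2 • site q - intVec (holeZ p')) = 0 := by
    intro q; rw [sqrt2_smul_site, hatH_intVec_fccPoint_sub]
  rcases κ with b' | s
  · exfalso
    rcases Bool.eq_false_or_eq_true b' with hb | hb
    · have hz' : z ∈ closedChamber (labelUp p).1 (labelUp p).2 := by simpa [labelOf, hb] using hz
      have hgb' : ∀ x ∈ closedChamber (labelUp p).1 (labelUp p).2,
          hatH (Real.sqrt 2 • x - intVec (holeZ p')) = ⟪g, x⟫ + b := by simpa [labelOf, hb] using hgb
      obtain ⟨t₀, t₁, t₂, -, -, -, -, hcombo⟩ := affine_eq_combo_labelUp p g b hz'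
      have hv : ∀ j : Fin 4, ⟪g, site (p + tetUpV j)⟫ + b = 0 := by
        intro j; rw [← hgb' _ (site_tetUpV_mem_closedChamber p j), hval]
      rw [← hgb' z hz', hv, hv, hv, hv] at hcombo
      linarith
    · have hz' : z ∈ closedChamber (labelDn p).1 (labelDn p).2 := by simpa [labelOf, hb] using hz
      have hgb' : ∀ x ∈ closedChamber (labelDn p).1 (labelDn p).2,
          hatH (Real.sqrt 2 • x - intVec (holeZ p')) = ⟪g, x⟫ + b := by simpa [labelOf, hb] using hgb
      obtain ⟨t₀, t₁, t₂, -, -, -, -, hcombo⟩ := affine_eq_combo_labelDn p g b hz'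
      have hv : ∀ j : Fin 4, ⟪g, site (p + tetDnV j)⟫ + b = 0 := by
        intro j; rw [← hgb' _ (site_tetDnV_mem_closedChamber p j), hval]
      rw [← hgb' z hz', hv, hv, hv, hv] at hcombo
      linarith
  · refine ⟨s, rfl, ?_⟩
    have hz' : z ∈ closedChamber (labelCorner p s).1 (labelCorner p s).2 := by simpa [labelOf] using hz
    have hgb' : ∀ x ∈ closedChamber (labelCorner p s).1 (labelCorner p s).2,
        hatH (Real.sqrt 2 • x - intVec (holeZ p')) = ⟪g, x⟫ + b := by simpa [labelOf] using hgb
    by_contra hp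
    obtain ⟨t₀, t₁, t₂, -, -, -, -, hcombo⟩ := affine_eq_combo_labelCorner p s g b hz'
    have hv : ∀ a : Fin 3, ⟪g, site (p + octV (octIdx a (s a)))⟫ + b = 0 := by
      intro a; rw [← hgb' _ (site_octV_mem_closedChamber p s a), hval]
    have hc : ⟪g, centre p⟫ + b = 0 := by
      rw [← hgb' _ (centre_mem_closedChamber p s), sqrt2_smul_centre, hatH_intVec_holeZ_sub, if_neg hp]
    rw [← hgb' z hz', hc, hv, hv, hv] at hcombo
    linarith

/-! ## The complex carries the tent -/

/-- The three labels as `labelOf`. -/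
theorem label_cases_labelOf {k : Fin 3 → ℤ} {m : Fin 4 → ℤ} {p : Site}
    (h : (k, m) = labelUp p ∨ (k, m) = labelDn p ∨ ∃ s : Fin 3 → Bool, (k, m) = labelCorner p s) :
    ∃ κ : Bool ⊕ (Fin 3 → Bool), (k, m) = labelOf p κ := by
  rcases h with h | h | ⟨s, h⟩
  · exact ⟨Sum.inl true, by simpa [labelOf] using h⟩
  · exact ⟨Sum.inl false, by simpa [labelOf] using h⟩
  · exact ⟨Sum.inr s, by simpa [labelOf] using h⟩

/-- Membership in `labelsOf`. -/
theorem labelOf_mem_labelsOf {X : Finset Site} {p : Site} (hp : p ∈ idx X) (κ : Bool ⊕ (Fin 3 → Bool)) :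
    labelOf p κ ∈ labelsOf X := by
  classical
  exact Finset.mem_image.2 ⟨(p, κ), Finset.mem_product.2 ⟨hp, Finset.mem_univ _⟩, rfl⟩

/-- **Near every point where the tent is positive there are points of the open cells of the complex.** -/
theorem exists_near_mem_cells_of_tent_pos (X : Finset Site) {x : EuclideanSpace ℝ (Fin 3)}
    (hx : 0 < tent X x) {ε : ℝ} (hε : 0 < ε) :
    ∃ z : EuclideanSpace ℝ (Fin 3), dist z x < ε ∧ ∃ ℓ ∈ labelsOf X, z ∈ cellOf ℓ.1 ℓ.2 := by
  -- an open ball where the tent stays positive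
  have hopen : IsOpen {y : EuclideanSpace ℝ (Fin 3) | 0 < tent X y} := isOpen_lt continuous_const (continuous_tent X)
  obtain ⟨r, hr, hball⟩ := Metric.isOpen_iff.1 hopen x hx
  obtain ⟨z, hzd, hz1, hz2⟩ := exists_near_off_planes x (lt_min hε hr)
  have hzpos : 0 < tent X z := hball (Metric.mem_ball.2 (lt_of_lt_of_le hzd (min_le_right _ _)))
  refine ⟨z, lt_of_lt_of_le hzd (min_le_left _ _), ?_⟩
  -- the floor chamber of `z` is a cell, classify it
  have hzc := mem_cellOf_floor hz1 hz2
  obtain ⟨p, hp⟩ := exists_label_of_mem_cellOf hzc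
  obtain ⟨κ, hκ⟩ := label_cases_labelOf hp
  have hzc' : z ∈ cellOf (labelOf p κ).1 (labelOf p κ).2 := by
    have h1 : (labelOf p κ).1 = fun i => ⌊Real.sqrt 2 * z i⌋ := (congrArg Prod.fst hκ).symm
    have h2 : (labelOf p κ).2 = fun j => ⌊⟪intVec (normal4 j), Real.sqrt 2 • z⟫ / 2⌋ :=
      (congrArg Prod.snd hκ).symm
    rw [h1, h2]; exact hzc
  have hzcl : z ∈ closedChamber (labelOf p κ).1 (labelOf p κ).2 := cellOf_subset_closedChamber _ _ hzc'
  -- its anchor is in `idx X`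
  have hpidx : p ∈ idx X := by
    rcases exists_pos_term_of_tent_pos hzpos with ⟨w, hw, hwpos⟩ | ⟨p', hp', -, hHpos⟩
    · exact anchor_mem_idx_of_hatL_pos hw p κ hzcl hwpos
    · obtain ⟨s, -, rfl⟩ := eq_corner_of_hatH_pos p p' κ hzcl hHpos
      exact hp'
  exact ⟨labelOf p κ, labelOf_mem_labelsOf hpidx κ, hzc'⟩

/-- **The complex carries the positivity set of the tent**:
`{f_X > 0} ⊆ ⋃_{ℓ ∈ labelsOf X} closure (cellOf ℓ)`. -/
theorem mem_closure_cells_of_tent_pos (X : Finset Site) {x : EuclideanSpace ℝ (Fin 3)} (hx : 0 < tent X x) :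
    x ∈ ⋃ ℓ ∈ labelsOf X, closure (cellOf ℓ.1 ℓ.2) := by
  have hcl : x ∈ closure (⋃ ℓ ∈ labelsOf X, cellOf ℓ.1 ℓ.2) := by
    rw [Metric.mem_closure_iff]
    intro ε hε
    obtain ⟨z, hzd, ℓ, hℓ, hz⟩ := exists_near_mem_cells_of_tent_pos X hx hε
    exact ⟨z, Set.mem_biUnion hℓ hz, by rw [dist_comm]; exact hzd⟩
  have heq : closure (⋃ ℓ ∈ labelsOf X, cellOf ℓ.1 ℓ.2) = ⋃ ℓ ∈ labelsOf X, closure (cellOf ℓ.1 ℓ.2) :=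
    Finset.closure_biUnion _ _
  rw [heq] at hcl
  exact hcl

/-- The positivity set of the tent, and hence every super-level set `{f_X > t}`, `t ≥ 0`, lies in the
closures of the cells of the complex. -/
theorem superlevel_subset_closure_cells (X : Finset Site) {t : ℝ} (ht : 0 ≤ t) :
    {x : EuclideanSpace ℝ (Fin 3) | t < tent X x} ⊆ ⋃ ℓ ∈ labelsOf X, closure (cellOf ℓ.1 ℓ.2) :=
  fun _ hx => mem_closure_cells_of_tent_pos X (lt_of_le_of_lt ht hx)

/-- Every index `i : Fin 6` is `octIdx a b`. -/
theorem exists_octIdx_eq (i : Fin 6) : ∃ a : Fin 3, ∃ bo : Bool, i = octIdx a bo := by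
  fin_cases i
  · exact ⟨0, false, rfl⟩
  · exact ⟨0, true, rfl⟩
  · exact ⟨1, true, rfl⟩
  · exact ⟨1, false, rfl⟩
  · exact ⟨2, true, rfl⟩
  · exact ⟨2, false, rfl⟩

/-! ## The positivity set lies within `√2` of the occupied sites -/

/-- An occupied octahedron pattern with positive centre value has an occupied vertex. -/
theorem exists_eq_true_of_twoAlpha_pos : ∀ bb : Fin 6 → Bool, 0 < twoAlpha bb → ∃ i, bb i = true := by
  decide

/-- Coordinates of `x − site q` in terms of `y = √2 • x − fccPoint q`. -/
theorem sub_site_apply (x : EuclideanSpace ℝ (Fin 3)) (q : Site) (l : Fin 3) :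
    (x - site q) l = (Real.sqrt 2)⁻¹ * (Real.sqrt 2 • x - intVec (fccPoint q)) l := by
  have hs : Real.sqrt 2 ≠ 0 := by positivity
  rw [site_eq]
  simp only [PiLp.sub_apply, PiLp.smul_apply, smul_eq_mul]
  field_simp

/-- **`{f_X > 0} ⊆ ⋃_{a ∈ X} closedBall (site a) √2`.** -/
theorem mem_balls_of_tent_pos (X : Finset Site) {x : EuclideanSpace ℝ (Fin 3)} (hx : 0 < tent X x) :
    x ∈ ⋃ a ∈ X, Metric.closedBall (site a) (Real.sqrt 2) := by
  have hs : (0 : ℝ) < Real.sqrt 2 := by positivity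
  have hs2 : Real.sqrt 2 ^ 2 = 2 := Real.sq_sqrt (by norm_num)
  rcases exists_pos_term_of_tent_pos hx with ⟨w, hw, hpos⟩ | ⟨p, -, hα, hpos⟩
  · -- a lattice hat: all three coordinates of `√2 x − W` are below `1`
    refine Set.mem_iUnion₂.2 ⟨w, hw, ?_⟩
    rw [Metric.mem_closedBall, EuclideanSpace.dist_eq]
    apply Real.sqrt_le_sqrt
    have hc := cubo_lt_one_of_hatL_pos hpos
    have hb : ∀ l : Fin 3, (x l - site w l) ^ 2 ≤ 1 / 2 := by
      intro l
      have h1 := lt_of_le_of_lt (abs_le_cubo (Real.sqrt 2 • x - intVec (fccPoint w)) l) hc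
      have h2 : x l - site w l = (x - site w) l := rfl
      rw [h2, sub_site_apply]
      rw [abs_lt] at h1
      have : ((Real.sqrt 2 • x - intVec (fccPoint w)) l) ^ 2 ≤ 1 := by nlinarith [h1.1, h1.2]
      rw [mul_pow, inv_pow, hs2]; nlinarith [this]
    simp only [Real.dist_eq, sq_abs]
    rw [Fin.sum_univ_three]
    linarith [hb 0, hb 1, hb 2]
  · -- a hole hat: `‖√2 x − H‖₁ < 1`, and an occupied vertex of that octahedron is within `√2`
    obtain ⟨i, hi⟩ := exists_eq_true_of_twoAlpha_pos _ hα
    have ha : p + octV i ∈ X := by simpa [patO] using hi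
    refine Set.mem_iUnion₂.2 ⟨p + octV i, ha, ?_⟩
    obtain ⟨a₀, bo, rfl⟩ := exists_octIdx_eq i
    rw [Metric.mem_closedBall, EuclideanSpace.dist_eq]
    apply Real.sqrt_le_sqrt
    have h1 := norm1_lt_one_of_hatH_pos hpos
    set y : EuclideanSpace ℝ (Fin 3) := Real.sqrt 2 • x - intVec (holeZ p) with hy
    have hcoord : ∀ l : Fin 3, (x l - site (p + octV (octIdx a₀ bo)) l) ^ 2 =
        ((y l - (if l = a₀ then sgnR bo else 0)) / Real.sqrt 2) ^ 2 := by
      intro l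
      rw [site_octV, centre_eq]
      simp only [hy, PiLp.add_apply, PiLp.sub_apply, PiLp.smul_apply, smul_eq_mul, PiLp.single_apply]
      congr 1
      field_simp
      split_ifs <;> ring
    have hσ : sgnR bo ^ 2 = 1 := by cases bo <;> simp [sgnR]
    have hσ' : |sgnR bo| = 1 := by cases bo <;> simp [sgnR]
    simp only [Real.dist_eq, sq_abs, hcoord, div_pow, hs2]
    rw [Fin.sum_univ_three]
    -- `(y_a − σ)² ≤ (|y_a|+1)²`, `y_l² ≤ |y_l|` for the others
    have hyl : ∀ l : Fin 3, |y l| < 1 := by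
      intro l; fin_cases l <;> simp <;> linarith [abs_nonneg (y 0), abs_nonneg (y 1), abs_nonneg (y 2)]
    have hsq : ∀ l : Fin 3, (y l) ^ 2 ≤ |y l| := by
      intro l; rw [← sq_abs]; nlinarith [abs_nonneg (y l), hyl l]
    have hmain : ∀ l : Fin 3, (y l - sgnR bo) ^ 2 ≤ 3 * |y l| + 1 := by
      intro l
      have : |y l - sgnR bo| ≤ |y l| + 1 := by
        calc |y l - sgnR bo| ≤ |y l| + |sgnR bo| := abs_sub _ _
          _ = |y l| + 1 := by rw [hσ']
      have h0 : 0 ≤ |y l| + 1 := by positivity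
      have h2 := sq_le_sq' (by linarith [abs_nonneg (y l - sgnR bo), neg_abs_le (y l - sgnR bo)]) this
      have h3 : |y l| ^ 2 ≤ |y l| := by rw [sq_abs]; exact hsq l
      nlinarith [h2, h3, sq_abs (y l - sgnR bo)]
    have e0 := hsq 0; have e1 := hsq 1; have e2 := hsq 2
    have m0 := hmain 0; have m1 := hmain 1; have m2 := hmain 2
    fin_cases a₀ <;> simp <;> linarith [abs_nonneg (y 0), abs_nonneg (y 1), abs_nonneg (y 2)]


end Summit.Ventures.Crystal3D.TentCertificate

end
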